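import Literature.Geometry.Symplectic.CompatibleComplexStructurePolar
import Literature.Geometry.Symplectic.AlmostComplexStructure
import Literature.Geometry.Riemannian.RiemannianMetricExists
import Literature.Geometry.Kaehler.ManifoldFormsChart
import Mathlib.Geometry.Manifold.VectorBundle.Hom
import HarnessLib

/-!
# Existence of compatible almost complex structures on a symplectic manifold

Topic `Literature/Geometry/Symplectic`. McDuff–Salamon, *Introduction to Symplectic Topology*
(3rd ed. 2017), **Prop. 4.1.1 (i)**: *for every nondegenerate `2`-form `ω` on a manifold `M`
the space `𝒥(M, ω)` of `ω`-compatible almost complex structures is nonempty* (indeed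
contractible). The printed proof (Prop. 2.5.6 and Prop. 4.1.1): choose a Riemannian metric `g`
and put `J_x := J_{g_x, ω_x}`, the `GL`-equivariant smooth function of
`CompatibleComplexStructurePolar.lean` applied fibrewise; smoothness of `x ↦ J_x` follows from
the smoothness of `g`, `ω` and of `(g, ω) ↦ J_{g,ω}`, and its equivariance (which makes the
construction chart-independent).

Main result: `exists_almostComplexStructure_isCompatibleWith` — on a `C^∞` manifold `M`
(boundaryless model with finite-dimensional inner-product model space `E`, Hausdorff,
σ-compact) every smooth everywhere-nondegenerate `2`-form `s` (`Literature.Geometry.Kaehler.MForm`)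
admits a `C^∞` almost complex structure `J : AlmostComplexStructure I ∞ M` with
`J.IsCompatibleWith s` (`AlmostComplexStructure.lean`: `s(v, Jv) > 0`, `s(Jv, Jw) = s(v, w)`).

Ingredients: the Riemannian metric from `Literature.Geometry.Riemannian.exists_isRiemannian`
(Lee 2012, Prop. 13.3); the Gram operators `gram B` of bilinear forms on the inner product space
`E` and `bilinOfAlt` (a `2`-form as a bilinear form); the polar construction `polarJOfMetric`
with its uniqueness/equivariance `polarJOfMetric_conj` and smoothness `contDiffOn_polarJOfMetric`;
Mathlib's smoothness criterion for sections of hom bundles `contMDiffAt_hom_bundle`, the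
in-coordinates expressions of `g` (`ContinuousLinearMap.inCoordinates_apply_eq₂`) and of `s`
(`Literature.Geometry.Kaehler.MForm.inChart_eq_of_mem_target`). Everything is proved; no named
facts.

## References

* D. McDuff, D. Salamon, *Introduction to Symplectic Topology*, 3rd ed., OUP (2017),
  Prop. 2.5.6, Prop. 4.1.1 (i). [McDuffSalamon2017]
* J. M. Lee, *Introduction to Smooth Manifolds*, 2nd ed. (2012), Prop. 13.3 (Riemannian metrics
  exist). [Lee2012]
-/

noncomputable section

open scoped Manifold ContDiff Topology RealInnerProductSpace
open Set Function Filter Module Literature.Analysis.OperatorTheory Literature.Geometry.Kaehler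

namespace Literature.Geometry.Symplectic

/-! ### Linear algebra: Gram operators of bilinear forms and of `2`-forms -/

section Gram

variable {E : Type*} [NormedAddCommGroup E] [InnerProductSpace ℝ E]

/-- Additivity of a `2`-form in its first argument. [folklore] -/
private theorem twoForm_add_left (α : E [⋀^Fin 2]→L[ℝ] ℝ) (x y w : E) :
    α ![x + y, w] = α ![x, w] + α ![y, w] :=
  α.toContinuousMultilinearMap.cons_add _ _ _

/-- Homogeneity of a `2`-form in its first argument. [folklore] -/
private theorem twoForm_smul_left (α : E [⋀^Fin 2]→L[ℝ] ℝ) (c : ℝ) (x w : E) :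
    α ![c • x, w] = c * α ![x, w] :=
  α.toContinuousMultilinearMap.cons_smul _ _ _

/-- Antisymmetry of a `2`-form. [folklore] -/
private theorem twoForm_swap (α : E [⋀^Fin 2]→L[ℝ] ℝ) (v w : E) : α ![v, w] = -α ![w, v] := by
  classical
  have h := α.map_swap ![w, v] (show (0 : Fin 2) ≠ 1 by decide)
  have hs : (![w, v] ∘ Equiv.swap (0 : Fin 2) 1) = ![v, w] := by
    funext i
    fin_cases i <;> rfl
  rw [hs] at h
  exact h

/-- Additivity of a `2`-form in its second argument. [folklore] -/
private theorem twoForm_add_right (α : E [⋀^Fin 2]→L[ℝ] ℝ) (v x y : E) :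
    α ![v, x + y] = α ![v, x] + α ![v, y] := by
  rw [twoForm_swap α v, twoForm_add_left, twoForm_swap α v x, twoForm_swap α v y]
  ring

/-- Homogeneity of a `2`-form in its second argument. [folklore] -/
private theorem twoForm_smul_right (α : E [⋀^Fin 2]→L[ℝ] ℝ) (c : ℝ) (v x : E) :
    α ![v, c • x] = c * α ![v, x] := by
  rw [twoForm_swap α v, twoForm_smul_left, twoForm_swap α v x]
  ring

omit [InnerProductSpace ℝ E] in
/-- The norm of a pair `![v, w]` as a product. [folklore] -/
private theorem prod_norm_vecTwo (v w : E) : ∏ i, ‖(![v, w] : Fin 2 → E) i‖ = ‖v‖ * ‖w‖ := by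
  rw [Fin.prod_univ_two]
  rfl

/-- **A continuous alternating `2`-form as a continuous bilinear form** `(v, w) ↦ α(v, w)`.
[folklore] -/
def bilinOfAlt (α : E [⋀^Fin 2]→L[ℝ] ℝ) : E →L[ℝ] E →L[ℝ] ℝ :=
  LinearMap.mkContinuous₂
    (LinearMap.mk₂ ℝ (fun v w ↦ α ![v, w]) (twoForm_add_left α)
      (fun c m n ↦ by rw [smul_eq_mul]; exact twoForm_smul_left α c m n) (twoForm_add_right α)
      (fun c m n ↦ by rw [smul_eq_mul]; exact twoForm_smul_right α c m n))
    ‖α‖ fun v w ↦ by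
      have h := α.le_opNorm ![v, w]
      rw [prod_norm_vecTwo, ← mul_assoc] at h
      exact h

/-- `bilinOfAlt α v w = α(v, w)`. [folklore] -/
@[simp] theorem bilinOfAlt_apply (α : E [⋀^Fin 2]→L[ℝ] ℝ) (v w : E) : bilinOfAlt α v w = α ![v, w] :=
  rfl

/-- `‖bilinOfAlt α‖ ≤ ‖α‖`. [folklore] -/
theorem norm_bilinOfAlt_le (α : E [⋀^Fin 2]→L[ℝ] ℝ) : ‖bilinOfAlt α‖ ≤ ‖α‖ :=
  LinearMap.mkContinuous₂_norm_le _ (norm_nonneg α) _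

/-- `α ↦ bilinOfAlt α` is a bounded linear map. [folklore] -/
theorem isBoundedLinearMap_bilinOfAlt :
    IsBoundedLinearMap ℝ (bilinOfAlt : (E [⋀^Fin 2]→L[ℝ] ℝ) → E →L[ℝ] E →L[ℝ] ℝ) where
  map_add α β := by
    ext v w
    rfl
  map_smul c α := by
    ext v w
    rfl
  bound := ⟨1, one_pos, fun α ↦ by rw [one_mul]; exact norm_bilinOfAlt_le α⟩

/-- `α ↦ bilinOfAlt α` is `C^∞`. [folklore] -/
theorem contDiff_bilinOfAlt :
    ContDiff ℝ ∞ (bilinOfAlt : (E [⋀^Fin 2]→L[ℝ] ℝ) → E →L[ℝ] E →L[ℝ] ℝ) :=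
  isBoundedLinearMap_bilinOfAlt.contDiff

variable [FiniteDimensional ℝ E]

/-- **The Gram operator of a continuous bilinear form** with respect to `⟪·, ·⟫`:
`⟪gram B v, w⟫ = B v w`; on the standard orthonormal basis `e`, `gram B v = Σᵢ B v eᵢ • eᵢ`. It is
assembled from Mathlib's continuous linear building blocks (flip, evaluation at `eᵢ`, rank-one
maps `smulRightL`) so that it is a continuous linear map of `B` by construction. [folklore] -/
def gram : (E →L[ℝ] E →L[ℝ] ℝ) →L[ℝ] (E →L[ℝ] E) :=
  ∑ i, ((ContinuousLinearMap.smulRightL ℝ E E).flip (stdOrthonormalBasis ℝ E i)).comp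
    ((ContinuousLinearMap.apply ℝ (E →L[ℝ] ℝ) (stdOrthonormalBasis ℝ E i)).comp
      ((ContinuousLinearMap.flipₗᵢ ℝ E E ℝ).toContinuousLinearEquiv :
        (E →L[ℝ] E →L[ℝ] ℝ) →L[ℝ] (E →L[ℝ] E →L[ℝ] ℝ)))

/-- Unfolding `gram`. [folklore] -/
theorem gram_apply (B : E →L[ℝ] E →L[ℝ] ℝ) (v : E) :
    gram B v = ∑ i, B v (stdOrthonormalBasis ℝ E i) • stdOrthonormalBasis ℝ E i := by
  simp [gram]

/-- **`⟪gram B v, w⟫ = B v w`.** [folklore] -/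
theorem inner_gram_left (B : E →L[ℝ] E →L[ℝ] ℝ) (v w : E) : ⟪gram B v, w⟫ = B v w := by
  set e := stdOrthonormalBasis ℝ E with he
  have hw : B v w = B v (∑ i, ⟪e i, w⟫ • e i) := by rw [e.sum_repr' w]
  rw [hw, map_sum, gram_apply, sum_inner]
  refine Finset.sum_congr rfl fun i _ ↦ ?_
  rw [real_inner_smul_left, map_smul, smul_eq_mul, mul_comm]

/-- The Gram operator of a symmetric positive definite form is symmetric positive definite.
[folklore] -/
theorem isPosDefSymm_gram {B : E →L[ℝ] E →L[ℝ] ℝ} (hsymm : ∀ v w, B v w = B w v)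
    (hpos : ∀ v, v ≠ 0 → 0 < B v v) : IsPosDefSymm (gram B) := by
  refine ⟨fun x y ↦ ?_, fun v hv ↦ ?_⟩
  · rw [inner_gram_left, hsymm, ← inner_gram_left, real_inner_comm]
  · rw [inner_gram_left]
    exact hpos v hv

/-- The Gram operator of a nondegenerate `2`-form is skew nondegenerate. [folklore] -/
theorem isSkewNondeg_gram_bilinOfAlt (α : E [⋀^Fin 2]→L[ℝ] ℝ)
    (hα : ∀ v : E, v ≠ 0 → ∃ w, α ![v, w] ≠ 0) : IsSkewNondeg (gram (bilinOfAlt α)) := by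
  refine ⟨fun x y ↦ ?_, fun v hv h0 ↦ ?_⟩
  · rw [inner_gram_left, bilinOfAlt_apply, twoForm_swap, ← bilinOfAlt_apply α y x,
      ← inner_gram_left, real_inner_comm]
  · obtain ⟨w, hw⟩ := hα v hv
    apply hw
    rw [← bilinOfAlt_apply, ← inner_gram_left, h0, inner_zero_left]

/-- **Transport of Gram operators**: if `B' v w = B (Ψ v) (Ψ w)` then
`gram B' = Ψ† · gram B · Ψ`. [folklore] -/
theorem gram_eq_adjoint_mul_gram_mul [CompleteSpace E] {B B' : E →L[ℝ] E →L[ℝ] ℝ} {Ψ : E →L[ℝ] E}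
    (h : ∀ v w, B' v w = B (Ψ v) (Ψ w)) :
    gram B' = ContinuousLinearMap.adjoint Ψ * gram B * Ψ := by
  refine ContinuousLinearMap.ext fun v ↦ ext_inner_right ℝ fun w ↦ ?_
  rw [inner_gram_left, h]
  change _ = ⟪ContinuousLinearMap.adjoint Ψ (gram B (Ψ v)), w⟫
  rw [ContinuousLinearMap.adjoint_inner_left, inner_gram_left]

end Gram

/-! ### Transport of forms along linear maps (chart changes) -/

section Transport

variable {E : Type*} [NormedAddCommGroup E] [InnerProductSpace ℝ E] [FiniteDimensional ℝ E]

/-- A symmetric positive definite bilinear form transported along an injective linear map has a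
symmetric positive definite Gram operator. [folklore] -/
theorem isPosDefSymm_gram_of_transport {B B' : E →L[ℝ] E →L[ℝ] ℝ} (hsymm : ∀ v w, B v w = B w v)
    (hpos : ∀ v, v ≠ 0 → 0 < B v v) {Ψ : E →L[ℝ] E} (hΨ : ∀ v, v ≠ 0 → Ψ v ≠ 0)
    (h : ∀ v w, B' v w = B (Ψ v) (Ψ w)) : IsPosDefSymm (gram B') :=
  isPosDefSymm_gram (fun v w ↦ by rw [h, h, hsymm]) fun v hv ↦ by
    rw [h]
    exact hpos _ (hΨ v hv)

/-- A nondegenerate `2`-form transported along a linear bijection has a skew nondegenerate Gram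
operator. [folklore] -/
theorem isSkewNondeg_gram_of_transport {α : E [⋀^Fin 2]→L[ℝ] ℝ}
    (hα : ∀ v : E, v ≠ 0 → ∃ w, α ![v, w] ≠ 0) {Ψ : E →L[ℝ] E} (hΨ : ∀ v, v ≠ 0 → Ψ v ≠ 0)
    (hΨs : Function.Surjective Ψ) {B' : E →L[ℝ] E →L[ℝ] ℝ}
    (h : ∀ v w, B' v w = α ![Ψ v, Ψ w]) : IsSkewNondeg (gram B') := by
  refine ⟨fun x y ↦ ?_, fun v hv h0 ↦ ?_⟩
  · rw [inner_gram_left, h, twoForm_swap, ← h, ← inner_gram_left, real_inner_comm]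
  · obtain ⟨w', hw'⟩ := hα _ (hΨ v hv)
    obtain ⟨w, rfl⟩ := hΨs w'
    apply hw'
    rw [← h, ← inner_gram_left, h0, inner_zero_left]

end Transport

/-! ### The fibrewise construction and its compatibility -/

section Manifold

variable {E : Type*} [NormedAddCommGroup E] [InnerProductSpace ℝ E]
  {H : Type*} [TopologicalSpace H] {I : ModelWithCorners ℝ E H}
  {M : Type*} [TopologicalSpace M] [ChartedSpace H M]

/-- **A `2`-form on `M` at `x`, read on the model space**: `s x` as a `2`-form on `E = T_x M` (the
identification `TangentSpace I x = E` is definitional; this wrapper only fixes the type so that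
the inner-product structure of `E` is found by unification). [folklore] -/
def formAt (s : MForm I M ℝ 2) (x : M) : E [⋀^Fin 2]→L[ℝ] ℝ := s x

/-- `formAt s x` is `s x`. [folklore] -/
theorem formAt_apply (s : MForm I M ℝ 2) (x : M) (v : Fin 2 → E) : formAt s x v = s x v := rfl

variable [FiniteDimensional ℝ E]

/-- **The fibrewise compatible complex structure** `J_x := J_{g_x, s_x}` of a field `g` of inner
products on the tangent spaces `T_x M = E` and a `2`-form `s` (McDuff–Salamon 2017, proof of
Prop. 4.1.1 (i): apply Prop. 2.5.6 in each tangent space), through the Gram operators with respect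
to the inner product of the model space `E`. [cite: McDuffSalamon2017, Prop. 4.1.1 (i)] -/
def fibrewiseJ (g : M → E →L[ℝ] E →L[ℝ] ℝ) (s : MForm I M ℝ 2) (x : M) : E →L[ℝ] E :=
  polarJOfMetric (gram (g x)) (gram (bilinOfAlt (formAt s x)))

variable {g : M → E →L[ℝ] E →L[ℝ] ℝ} {s : MForm I M ℝ 2}

section Pointwise

variable (hgs : ∀ x v w, g x v w = g x w v) (hgp : ∀ x v, v ≠ 0 → 0 < g x v v)
  (hnd : ∀ (x : M) (v : E), v ≠ 0 → ∃ w : E, formAt s x ![v, w] ≠ 0)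
include hgs hgp hnd

/-- **`J_x² = -1`.** [cite: McDuffSalamon2017, Prop. 4.1.1 (i)] -/
theorem fibrewiseJ_fibrewiseJ (x : M) (v : E) : fibrewiseJ g s x (fibrewiseJ g s x v) = -v :=
  polarJOfMetric_polarJOfMetric_apply (isPosDefSymm_gram (hgs x) (hgp x))
    (isSkewNondeg_gram_bilinOfAlt _ (hnd x)) v

/-- **`J_x` is tamed by `s`**: `s(v, J v) > 0` for `v ≠ 0`. [cite: McDuffSalamon2017, Prop. 4.1.1 (i)] -/
theorem form_self_fibrewiseJ_pos (x : M) {v : E} (hv : v ≠ 0) :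
    0 < formAt s x ![v, fibrewiseJ g s x v] := by
  have h := inner_gram_self_polarJOfMetric_pos (isPosDefSymm_gram (hgs x) (hgp x))
    (isSkewNondeg_gram_bilinOfAlt _ (hnd x)) hv
  rwa [inner_gram_left, bilinOfAlt_apply] at h

/-- **`s` is `J`-invariant**: `s(J v, J w) = s(v, w)`. [cite: McDuffSalamon2017, Prop. 4.1.1 (i)] -/
theorem form_fibrewiseJ_fibrewiseJ (x : M) (v w : E) :
    formAt s x ![fibrewiseJ g s x v, fibrewiseJ g s x w] = formAt s x ![v, w] := by
  have h := inner_gram_polarJOfMetric (isPosDefSymm_gram (hgs x) (hgp x))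
    (isSkewNondeg_gram_bilinOfAlt _ (hnd x)) v w
  rwa [inner_gram_left, bilinOfAlt_apply, inner_gram_left, bilinOfAlt_apply] at h

/-- **`J_x` is `g`-orthogonal**: `g(J v, J w) = g(v, w)`. [cite: McDuffSalamon2017, Prop. 2.5.6 (2.5.10)] -/
theorem metric_fibrewiseJ_fibrewiseJ (x : M) (v w : E) :
    g x (fibrewiseJ g s x v) (fibrewiseJ g s x w) = g x v w := by
  have h := inner_metric_polarJOfMetric (isPosDefSymm_gram (hgs x) (hgp x))
    (isSkewNondeg_gram_bilinOfAlt _ (hnd x)) v w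
  rwa [inner_gram_left, inner_gram_left] at h

end Pointwise

/-! ### Smoothness of `x ↦ J_x` as a section of `End(TM)` -/

section Smooth

variable [IsManifold I ∞ M]

variable (I) in
/-- The in-coordinates expression of the field of bilinear forms `g` (a section of
`Hom(TM, Hom(TM, ℝ))`) in the trivialisation at `x₀`, read at `x`. [folklore] -/
def metricInCoord (g : M → E →L[ℝ] E →L[ℝ] ℝ) (x₀ x : M) : E →L[ℝ] E →L[ℝ] ℝ :=
  ContinuousLinearMap.inCoordinates E (TangentSpace I : M → Type _) (E →L[ℝ] ℝ)
    (fun y : M ↦ TangentSpace I y →L[ℝ] ℝ) x₀ x x₀ x (g x)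

/-- The chart representative of the `2`-form `s` at `x₀`, read at `x`, as a bilinear form.
[folklore] -/
def formInCoord (s : MForm I M ℝ 2) (x₀ x : M) : E →L[ℝ] E →L[ℝ] ℝ :=
  bilinOfAlt (s.inChart x₀ (extChartAt I x₀ x))

omit [FiniteDimensional ℝ E] in
/-- Points of the chart domain of `x₀` lie in the base set of the tangent trivialisation at `x₀`.
[folklore] -/
private theorem mem_baseSet_of_mem_source {x₀ x : M} (hx : x ∈ (chartAt H x₀).source) :
    x ∈ (trivializationAt E (TangentSpace I : M → Type _) x₀).baseSet := by
  rwa [TangentBundle.trivializationAt_baseSet]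

omit [FiniteDimensional ℝ E] in
/-- Over the chart domain the inverse tangent trivialisation is injective. [folklore] -/
theorem symmL_trivializationAt_ne_zero {x₀ x : M} (hx : x ∈ (chartAt H x₀).source) {v : E}
    (hv : v ≠ 0) : (trivializationAt E (TangentSpace I : M → Type _) x₀).symmL ℝ x v ≠ 0 :=
  fun h0 ↦ hv (by
    have h := congrArg
      ((trivializationAt E (TangentSpace I : M → Type _) x₀).continuousLinearMapAt ℝ x) h0
    rwa [Bundle.Trivialization.continuousLinearMapAt_symmL _ (mem_baseSet_of_mem_source hx),
      map_zero] at h)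

omit [FiniteDimensional ℝ E] in
/-- Over the chart domain the inverse tangent trivialisation is surjective. [folklore] -/
theorem symmL_trivializationAt_surjective {x₀ x : M} (hx : x ∈ (chartAt H x₀).source) :
    Function.Surjective ((trivializationAt E (TangentSpace I : M → Type _) x₀).symmL ℝ x) :=
  fun w ↦ ⟨_, Bundle.Trivialization.symmL_continuousLinearMapAt _ (mem_baseSet_of_mem_source hx) w⟩

omit [FiniteDimensional ℝ E] in
/-- `g` is smooth in coordinates (Mathlib's `contMDiffAt_hom_bundle`). [folklore] -/
theorem contMDiffAt_metricInCoord
    (hg : ContMDiff I (I.prod 𝓘(ℝ, E →L[ℝ] E →L[ℝ] ℝ)) ∞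
      (fun x : M ↦ Bundle.TotalSpace.mk' (E →L[ℝ] E →L[ℝ] ℝ)
        (E := fun y : M ↦ TangentSpace I y →L[ℝ] TangentSpace I y →L[ℝ] ℝ) x (g x)))
    (x₀ : M) : ContMDiffAt I 𝓘(ℝ, E →L[ℝ] E →L[ℝ] ℝ) ∞ (metricInCoord I g x₀) x₀ :=
  ((contMDiffAt_hom_bundle _).1 (hg x₀)).2

omit [FiniteDimensional ℝ E] [IsManifold I ∞ M] in
/-- The chart representative of a smooth form, composed with the chart, is smooth at the centre.
[folklore] -/
theorem contMDiffAt_formInCoord (hs : IsSmoothForm s) (x₀ : M) :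
    ContMDiffAt I 𝓘(ℝ, E →L[ℝ] E →L[ℝ] ℝ) ∞ (formInCoord s x₀) x₀ := by
  have h1 : ContMDiffWithinAt I 𝓘(ℝ, E [⋀^Fin 2]→L[ℝ] ℝ) ∞ (s.inChart x₀ ∘ extChartAt I x₀)
      univ x₀ :=
    (hs x₀).comp_contMDiffWithinAt contMDiffAt_extChartAt.contMDiffWithinAt fun x _ ↦ by
      simp only [mem_preimage, extChartAt_coe, comp_apply, mem_range_self]
  exact contDiff_bilinOfAlt.comp_contMDiffAt (contMDiffWithinAt_univ.1 h1)

omit [FiniteDimensional ℝ E] in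
/-- The in-coordinates metric on the chart domain: `g_x` transported along the inverse tangent
trivialisation. [folklore] -/
theorem metricInCoord_apply {x₀ x : M} (hx : x ∈ (chartAt H x₀).source) (v w : E) :
    metricInCoord I g x₀ x v w =
      g x ((trivializationAt E (TangentSpace I : M → Type _) x₀).symmL ℝ x v)
        ((trivializationAt E (TangentSpace I : M → Type _) x₀).symmL ℝ x w) := by
  have hxb := mem_baseSet_of_mem_source (I := I) hx
  rw [metricInCoord, inCoordinates_apply_eq₂ hxb hxb (mem_univ _),
    Bundle.Trivialization.symmL_apply _ hxb, Bundle.Trivialization.symmL_apply _ hxb]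
  simp only [Bundle.Trivial.fiberBundle_trivializationAt', Bundle.Trivial.linearMapAt_trivialization,
    LinearMap.id_coe, id_eq]
  -- the two sides differ only through the definitional identification `TangentSpace I x = E`
  rfl

omit [FiniteDimensional ℝ E] in
/-- The chart representative of `s` on the chart domain: `s_x` transported along the inverse
tangent trivialisation (`MForm.inChart_eq_of_mem_target`,
`TangentBundle.symmL_trivializationAt_eq_core`). [folklore] -/
theorem formInCoord_apply {x₀ x : M} (hx : x ∈ (chartAt H x₀).source) (v w : E) :
    formInCoord s x₀ x v w =
      formAt s x
        ![(trivializationAt E (TangentSpace I : M → Type _) x₀).symmL ℝ x v,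
          (trivializationAt E (TangentSpace I : M → Type _) x₀).symmL ℝ x w] := by
  have hxs : x ∈ (extChartAt I x₀).source := by rwa [extChartAt_source]
  rw [formInCoord, bilinOfAlt_apply,
    s.inChart_eq_of_mem_target ((extChartAt I x₀).map_source hxs), (extChartAt I x₀).left_inv hxs,
    ContinuousAlternatingMap.compContinuousLinearMap_apply,
    TangentBundle.symmL_trivializationAt_eq_core hx]
  congr 1
  funext i
  fin_cases i <;> rfl

/-- On the chart domain the in-coordinates metric has a symmetric positive definite Gram
operator. [folklore] -/
theorem isPosDefSymm_gram_metricInCoord (hgs : ∀ x v w, g x v w = g x w v)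
    (hgp : ∀ x v, v ≠ 0 → 0 < g x v v) {x₀ x : M} (hx : x ∈ (chartAt H x₀).source) :
    IsPosDefSymm (gram (metricInCoord I g x₀ x)) :=
  isPosDefSymm_gram_of_transport (hgs x) (hgp x) (fun _ hv ↦ symmL_trivializationAt_ne_zero hx hv)
    (metricInCoord_apply hx)

/-- On the chart domain the chart representative of a nondegenerate `s` has a skew nondegenerate
Gram operator. [folklore] -/
theorem isSkewNondeg_gram_formInCoord
    (hnd : ∀ (x : M) (v : E), v ≠ 0 → ∃ w : E, formAt s x ![v, w] ≠ 0)
    {x₀ x : M} (hx : x ∈ (chartAt H x₀).source) :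
    IsSkewNondeg (gram (formInCoord s x₀ x)) :=
  isSkewNondeg_gram_of_transport (hnd x) (fun _ hv ↦ symmL_trivializationAt_ne_zero hx hv)
    (symmL_trivializationAt_surjective hx) (formInCoord_apply hx)

variable [CompleteSpace E]

/-- **The in-coordinates expression of `J` is the `J` of the in-coordinates data** (equivariance,
`polarJOfMetric_conj`): for `x` in the chart domain of `x₀`, with `Φ` the tangent trivialisation
at `x₀` read at `x`, `Φ J_x Φ⁻¹ = J(gram (g_x ∘ (Φ⁻¹ × Φ⁻¹)), gram (s_x ∘ (Φ⁻¹ × Φ⁻¹)))`.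
[cite: McDuffSalamon2017, Prop. 2.5.6] -/
theorem inCoordinates_fibrewiseJ (hgs : ∀ x v w, g x v w = g x w v)
    (hgp : ∀ x v, v ≠ 0 → 0 < g x v v)
    (hnd : ∀ (x : M) (v : E), v ≠ 0 → ∃ w : E, formAt s x ![v, w] ≠ 0)
    {x₀ x : M} (hx : x ∈ (chartAt H x₀).source) :
    ContinuousLinearMap.inCoordinates E (TangentSpace I : M → Type _) E
        (TangentSpace I : M → Type _) x₀ x x₀ x (fibrewiseJ (E := E) g s x) =
      polarJOfMetric (gram (metricInCoord I g x₀ x)) (gram (formInCoord s x₀ x)) := by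
  have hxb := mem_baseSet_of_mem_source (I := I) hx
  set Φ : E ≃L[ℝ] E :=
    (trivializationAt E (TangentSpace I : M → Type _) x₀).continuousLinearEquivAt ℝ x hxb
  have hΨ : ((Φ.symm : E ≃L[ℝ] E) : E →L[ℝ] E) =
      (trivializationAt E (TangentSpace I : M → Type _) x₀).symmL ℝ x :=
    Bundle.Trivialization.symm_continuousLinearEquivAt_eq' _ hxb
  have hG : gram (metricInCoord I g x₀ x) =
      ContinuousLinearMap.adjoint (Φ.symm : E →L[ℝ] E) * gram (g x) * (Φ.symm : E →L[ℝ] E) :=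
    gram_eq_adjoint_mul_gram_mul fun v w ↦ by rw [metricInCoord_apply hx, ← hΨ]; rfl
  have hΩ : gram (formInCoord s x₀ x) =
      ContinuousLinearMap.adjoint (Φ.symm : E →L[ℝ] E) *
        gram (bilinOfAlt (formAt s x)) * (Φ.symm : E →L[ℝ] E) :=
    gram_eq_adjoint_mul_gram_mul fun v w ↦ by
      rw [formInCoord_apply hx, bilinOfAlt_apply, ← hΨ]; rfl
  -- both sides are `Φ ∘ J_x ∘ Φ⁻¹`, up to the association of the compositions
  rw [hG, hΩ, polarJOfMetric_conj (isPosDefSymm_gram (hgs x) (hgp x))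
    (isSkewNondeg_gram_bilinOfAlt _ (hnd x)) Φ, ContinuousLinearMap.inCoordinates_eq hxb hxb,
    ContinuousLinearMap.mul_def, ContinuousLinearMap.mul_def, ContinuousLinearMap.comp_assoc]
  rfl

/-- **The fibrewise compatible complex structure is a smooth section of `End(TM)`** when `g` is
a `C^∞` field of inner products (a section of `Hom(TM, Hom(TM, ℝ))`) and `s` a smooth
nondegenerate `2`-form: in the trivialisation at `x₀` it is `J` of the in-coordinates
expressions of `g` and `s` (`inCoordinates_fibrewiseJ`), which are smooth, and `(G, Ω) ↦ J` is
smooth (`contDiffOn_polarJOfMetric`). [cite: McDuffSalamon2017, Prop. 4.1.1 (i)] -/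
theorem contMDiff_fibrewiseJ
    (hg : ContMDiff I (I.prod 𝓘(ℝ, E →L[ℝ] E →L[ℝ] ℝ)) ∞
      (fun x : M ↦ Bundle.TotalSpace.mk' (E →L[ℝ] E →L[ℝ] ℝ)
        (E := fun y : M ↦ TangentSpace I y →L[ℝ] TangentSpace I y →L[ℝ] ℝ) x (g x)))
    (hgs : ∀ x v w, g x v w = g x w v) (hgp : ∀ x v, v ≠ 0 → 0 < g x v v)
    (hs : IsSmoothForm s)
    (hnd : ∀ (x : M) (v : E), v ≠ 0 → ∃ w : E, formAt s x ![v, w] ≠ 0) :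
    ContMDiff I (I.prod 𝓘(ℝ, E →L[ℝ] E)) ∞
      (fun x : M ↦ Bundle.TotalSpace.mk' (E →L[ℝ] E)
        (E := fun y : M ↦ TangentSpace I y →L[ℝ] TangentSpace I y) x
          (fibrewiseJ (E := E) g s x)) := by
  intro x₀
  rw [contMDiffAt_hom_bundle]
  refine ⟨contMDiffAt_id, ?_⟩
  have hsource : (chartAt H x₀).source ∈ 𝓝 x₀ :=
    (chartAt H x₀).open_source.mem_nhds (mem_chart_source H x₀)
  -- the smooth model `x ↦ J(gram (metricInCoord x), gram (formInCoord x))`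
  have hpair : ContMDiffAt I 𝓘(ℝ, (E →L[ℝ] E) × (E →L[ℝ] E)) ∞
      (fun x ↦ (gram (metricInCoord I g x₀ x), gram (formInCoord s x₀ x))) x₀ :=
    ((gram (E := E)).contDiff.comp_contMDiffAt (contMDiffAt_metricInCoord hg x₀)).prodMk_space
      ((gram (E := E)).contDiff.comp_contMDiffAt (contMDiffAt_formInCoord hs x₀))
  have hpt : (gram (metricInCoord I g x₀ x₀), gram (formInCoord s x₀ x₀)) ∈ polarDomain E :=
    ⟨isPosDefSymm_gram_metricInCoord hgs hgp (mem_chart_source H x₀),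
      isSkewNondeg_gram_formInCoord hnd (mem_chart_source H x₀)⟩
  have hmodel : ContMDiffAt I 𝓘(ℝ, E →L[ℝ] E) ∞
      (fun x ↦ polarJOfMetric (gram (metricInCoord I g x₀ x)) (gram (formInCoord s x₀ x))) x₀ :=
    (ContDiffWithinAt.comp_contMDiffWithinAt (s := (chartAt H x₀).source) (t := polarDomain E)
      (g := fun p : (E →L[ℝ] E) × (E →L[ℝ] E) ↦ polarJOfMetric p.1 p.2)
      (contDiffOn_polarJOfMetric _ hpt) hpair.contMDiffWithinAt fun x hx ↦
        ⟨isPosDefSymm_gram_metricInCoord hgs hgp hx, isSkewNondeg_gram_formInCoord hnd hx⟩).contMDiffAt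
      hsource
  -- conclude by equivariance on the chart domain
  refine hmodel.congr_of_eventuallyEq ?_
  filter_upwards [hsource] with x hx
  exact inCoordinates_fibrewiseJ hgs hgp hnd hx

/-- **The compatible almost complex structure of a metric and a nondegenerate `2`-form**
(McDuff–Salamon 2017, Prop. 4.1.1 (i) with Prop. 2.5.6: `J := J_{g,ω}` fibrewise).
[cite: McDuffSalamon2017, Prop. 4.1.1 (i)] -/
def compatibleAlmostComplexStructure
    (hg : ContMDiff I (I.prod 𝓘(ℝ, E →L[ℝ] E →L[ℝ] ℝ)) ∞
      (fun x : M ↦ Bundle.TotalSpace.mk' (E →L[ℝ] E →L[ℝ] ℝ)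
        (E := fun y : M ↦ TangentSpace I y →L[ℝ] TangentSpace I y →L[ℝ] ℝ) x (g x)))
    (hgs : ∀ x v w, g x v w = g x w v) (hgp : ∀ x v, v ≠ 0 → 0 < g x v v)
    (hs : IsSmoothForm s)
    (hnd : ∀ (x : M) (v : E), v ≠ 0 → ∃ w : E, formAt s x ![v, w] ≠ 0) :
    AlmostComplexStructure I ∞ M where
  toFun x := fibrewiseJ (E := E) g s x
  map_map' x v := fibrewiseJ_fibrewiseJ hgs hgp hnd x v
  contMDiff' := contMDiff_fibrewiseJ hg hgs hgp hs hnd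

/-- The structure `compatibleAlmostComplexStructure` is, pointwise, `fibrewiseJ`. [folklore] -/
theorem compatibleAlmostComplexStructure_apply
    (hg : ContMDiff I (I.prod 𝓘(ℝ, E →L[ℝ] E →L[ℝ] ℝ)) ∞
      (fun x : M ↦ Bundle.TotalSpace.mk' (E →L[ℝ] E →L[ℝ] ℝ)
        (E := fun y : M ↦ TangentSpace I y →L[ℝ] TangentSpace I y →L[ℝ] ℝ) x (g x)))
    (hgs : ∀ x v w, g x v w = g x w v) (hgp : ∀ x v, v ≠ 0 → 0 < g x v v)
    (hs : IsSmoothForm s)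
    (hnd : ∀ (x : M) (v : E), v ≠ 0 → ∃ w : E, formAt s x ![v, w] ≠ 0) (x : M) :
    (compatibleAlmostComplexStructure hg hgs hgp hs hnd x : E →L[ℝ] E) = fibrewiseJ g s x :=
  rfl

/-- The almost complex structure `compatibleAlmostComplexStructure` is `s`-compatible
(`s(v, Jv) > 0`, `s(Jv, Jw) = s(v, w)`). [cite: McDuffSalamon2017, Prop. 4.1.1 (i)] -/
theorem isCompatibleWith_compatibleAlmostComplexStructure
    (hg : ContMDiff I (I.prod 𝓘(ℝ, E →L[ℝ] E →L[ℝ] ℝ)) ∞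
      (fun x : M ↦ Bundle.TotalSpace.mk' (E →L[ℝ] E →L[ℝ] ℝ)
        (E := fun y : M ↦ TangentSpace I y →L[ℝ] TangentSpace I y →L[ℝ] ℝ) x (g x)))
    (hgs : ∀ x v w, g x v w = g x w v) (hgp : ∀ x v, v ≠ 0 → 0 < g x v v)
    (hs : IsSmoothForm s)
    (hnd : ∀ (x : M) (v : E), v ≠ 0 → ∃ w : E, formAt s x ![v, w] ≠ 0) :
    (compatibleAlmostComplexStructure hg hgs hgp hs hnd).IsCompatibleWith s :=
  ⟨fun x _ hv ↦ form_self_fibrewiseJ_pos hgs hgp hnd x hv,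
    fun x v w ↦ form_fibrewiseJ_fibrewiseJ hgs hgp hnd x v w⟩

/-- The almost complex structure `compatibleAlmostComplexStructure` is `g`-orthogonal
(McDuff–Salamon 2017, (2.5.10): `g(Jv, Jw) = g(v, w)`). [cite: McDuffSalamon2017, Prop. 2.5.6 (2.5.10)] -/
theorem metric_compatibleAlmostComplexStructure
    (hg : ContMDiff I (I.prod 𝓘(ℝ, E →L[ℝ] E →L[ℝ] ℝ)) ∞
      (fun x : M ↦ Bundle.TotalSpace.mk' (E →L[ℝ] E →L[ℝ] ℝ)
        (E := fun y : M ↦ TangentSpace I y →L[ℝ] TangentSpace I y →L[ℝ] ℝ) x (g x)))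
    (hgs : ∀ x v w, g x v w = g x w v) (hgp : ∀ x v, v ≠ 0 → 0 < g x v v)
    (hs : IsSmoothForm s)
    (hnd : ∀ (x : M) (v : E), v ≠ 0 → ∃ w : E, formAt s x ![v, w] ≠ 0)
    (x : M) (v w : E) :
    g x (compatibleAlmostComplexStructure hg hgs hgp hs hnd x v)
      (compatibleAlmostComplexStructure hg hgs hgp hs hnd x w) = g x v w :=
  metric_fibrewiseJ_fibrewiseJ hgs hgp hnd x v w

end Smooth

/-! ### Existence -/

/-- **Existence of compatible almost complex structures** (McDuff–Salamon 2017,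
Prop. 4.1.1 (i): "`𝒥(M, ω)` is nonempty"): on a Hausdorff σ-compact `C^∞` manifold modelled on a
finite-dimensional inner-product space, every smooth everywhere-nondegenerate `2`-form `s`
admits a `C^∞` `s`-compatible almost complex structure — `J_{g,s}` for a Riemannian metric `g`,
which exists by Lee 2012, Prop. 13.3 (the tree's `exists_isRiemannian`).
[cite: McDuffSalamon2017, Prop. 4.1.1 (i)] -/
theorem exists_almostComplexStructure_isCompatibleWith [IsManifold I ∞ M] [T2Space M]
    [SigmaCompactSpace M] (s : MForm I M ℝ 2) (hs : IsSmoothForm s)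
    (hnd : ∀ (x : M) (v : TangentSpace I x), v ≠ 0 → ∃ w : TangentSpace I x, s x ![v, w] ≠ 0) :
    ∃ J : AlmostComplexStructure I ∞ M, J.IsCompatibleWith s := by
  haveI : CompleteSpace E := FiniteDimensional.complete ℝ E
  obtain ⟨gR, hgR⟩ := Literature.Geometry.Riemannian.exists_isRiemannian (I := I) (M := M)
  exact ⟨compatibleAlmostComplexStructure (g := fun x ↦ (gR.val x : E →L[ℝ] E →L[ℝ] ℝ)) (s := s)
      gR.contMDiff gR.symm hgR hs hnd,
    isCompatibleWith_compatibleAlmostComplexStructure _ _ _ _ _⟩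

end Manifold

end Literature.Geometry.Symplectic

end
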